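import Summits.MatrixMultiplication.MatrixMultiplication.Theorems.SoloInformedValPureHubReduction

/-!
# The pure hub statement fails in `ZMod 40`

Solo-informed MatrixMultiplication, gen 81 (dossier `paper/val-superlinear.md` §15.8 (n)(xii), (xiii); CLAIMS c587–c589).

`SoloInformedValPureHubReduction` reduced the packing bound `T ≤ |G|` for hub pairs to the PURE HUB STATEMENT
`PureHubStatement G` and recorded that statement as a conjecture.  It is FALSE: in `ZMod 40` take

  `A₁ = {7, 17, 27, 37}` (a coset of `⟨10⟩`), `A₂ = {0, 8, 16, 32}`, `Y₁ = {8, 16, 24, 32}`, `Y₂ = {1, 11, 21}`.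

All eight hypotheses hold (the sums `A_s + Y_s` are uniquely represented because `⟨8⟩ ∩ ⟨10⟩ = 0`; the cross
translates are disjoint by parity; `7 ∈ A₁` and `16 ∈ A₂` are hub elements), but
`|(A₁ ∪ A₂) + (Y₁ ∪ Y₂)| = 27 < 28 = |A₁||Y₁| + |A₂||Y₂|` (`not_pureHubStatement_zmod40`, by `decide`).  The witness
even lifts to an accidental-free hub pair of blocks (`X₁ = A₁`, `Z₁ = {0}`, `X₂ = {31, 39, 7, 23}`, `Z₂ = {31}`, hub row
`7`, `T = 28 ≤ 40`; seat computation c589), so the super-additivity inequality `v₁ + v₂ ≤ |A + Y|` fails for hub pairs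
as well, while the packing bound `T ≤ |G|` itself is not contradicted.  Consequently the reduction theorem
`NoAccidental.card_triangleSet_le_card_of_pureHub` cannot be fed in `ZMod 40`; any proof of `T ≤ |G|` for hub pairs
must use room outside the four mixed images `X_a + Y_b - Z_c`.  No `sorry`.
-/

namespace Summit.MatrixMultiplication.MatrixMultiplication.Theorems.SoloVal

open Finset Pointwise

/-- The pure hub statement is false in `ZMod 40`: the sets `A₁ = {7,17,27,37}`, `A₂ = {0,8,16,32}`,
`Y₁ = {8,16,24,32}`, `Y₂ = {1,11,21}` satisfy its hypotheses (hubs `7` and `16`) and have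
`|(A₁ ∪ A₂) + (Y₁ ∪ Y₂)| = 27 < 28`. -/
theorem not_pureHubStatement_zmod40 : ¬ PureHubStatement (ZMod 40) := by
  intro h
  have h28 := h ({7, 17, 27, 37} : Finset (ZMod 40)) ({0, 8, 16, 32} : Finset (ZMod 40))
    ({8, 16, 24, 32} : Finset (ZMod 40)) ({1, 11, 21} : Finset (ZMod 40))
    (by decide) (by decide) (by decide) (by decide) (by decide) (by decide) (by decide) (by decide)
  revert h28
  decide

end Summit.MatrixMultiplication.MatrixMultiplication.Theorems.SoloVal
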